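import Summits.HubbardSuperconductivity.HubbardSuperconductivity.Theses.AnisotropyChord
import Summits.HubbardSuperconductivity.HubbardSuperconductivity.Theorems.AnisotropyChordChordToOrderXY
import Summits.AtomisticToContinuum.BoseEinsteinCondensation.Theorems.BECStronglyRayleighSectorGroundStatePerron
import Literature.MathematicalPhysics.QuantumLattice.SpinChainsLiebMattisProofs

/-!
# Crux `ChordFM` (stmt-HubbardSuperconductivity-8147) — line `concavity-af`
# (crux-strategist, 2026-08-17): AF-side CONCAVITY ⇒ the piece `ChordXY`, composed with the FM-side
# piece `stub_ferroSideChord` to the crux `ChordFM` by name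

Notation: `H_M(Δ) = xxzHamiltonian 1 (torusGraph 2 M) (-1) Δ`, `Λ(ψ) = Re⟨ψ, S⁺_tot S⁻_tot ψ⟩`,
`S = M²/2`.

Stubs:
* `stub_concavityAF` — three-point concavity of `Δ ↦ Λ_M(Δ)` on the ANTIFERROMAGNETIC side `[-1,0]`
  only (`-1 ≤ Δ₁ ≤ Δ₂ ≤ Δ₃ ≤ 0`): the refuter-suggested restatement of the structural parent
  `Concavity` (stmt-8150) after its large-M LSW counter-evidence on the ferromagnetic side (0,1)
  (EVIDENCE_Concavity8150_LSW.md: the M=∞ curve is convex on (0,1), first finite-M violation near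
  (0, 0.5, 1) at M ≈ 24). Intended engine (card): the finite-β variance-comparison identity
  `(log Λ_β)'' = Var_worm(𝒜) − Var_closed(𝒜)` in the stoquastic path-integral representation, then
  `β → ∞` at fixed `M`. M = ∞ plausibility on the AF side: `m²(Δ) ≈ m_s² + c√(1+Δ)` near the
  Heisenberg point (LSW, easy-plane HAF) is concave and increasing; ED (card): all second
  differences negative on [-1.1, 0] (4×4, √20×√20).
* `stub_ferroSideChord` — the FM-side piece `FerroSideChord` (shared with line `split-chordxy-ferroside`).
PROVED here (not stubs): `exists_unit_sectorGroundState_xxz` (a normalised `S^z_tot = 0` sector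
ground state of `H_M(Δ)` exists for EVERY `Δ`, by the BEC route's stoquastic sector Perron theorem)
and `lam_nonneg` (`Λ(ψ) = ‖S⁻_tot ψ‖² ≥ 0`).
Compositions: `ChordXY_of : concavityAF → ChordXY` (concavity at `(-1, Δ, 0)` reads
`(-Δ)·Λ(ψ₋₁) + (Δ+1)·Λ(ψ₀) ≤ Λ(ψ)`; drop the first term) and `ChordFM_of : concavityAF →
FerroSideChord → ChordFM` (through `ChordXY` and the split assembly).
Disproof used: none exists for this crux. Dead lines: none registered.
-/

namespace Summit.HubbardSuperconductivity.HubbardSuperconductivity.Cruxes.ChordFM.ConcavityAF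

open Matrix Literature.MathematicalPhysics.QuantumLattice Literature.Probability.LatticeModels
open Summit.HubbardSuperconductivity.HubbardSuperconductivity.Theses.AnisotropyChord
open Summit.HubbardSuperconductivity.HubbardSuperconductivity.Theorems.AnisotropyChord
  (exists_unit_sectorGroundState_xy)
open Summit.AtomisticToContinuum.BoseEinsteinCondensation.Theorems.BECStronglyRayleighSectorPerron
  (stoquastic_sector_perronFrobenius exists_config_weight_eq torusGraph_connected)
open Summit.AtomisticToContinuum.BoseEinsteinCondensation.Theorems.InsertionFieldDelocalisation.Negative
  (card_torusSite)
open Summit.AtomisticToContinuum.BoseEinsteinCondensation.Cruxes.GroundStateStability.StableConeVariationalSelection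
  (leadPF_entries)

/-- STUB 1 — three-point CONCAVITY of `Δ ↦ Λ_M(Δ)` on the ANTIFERROMAGNETIC side `[-1,0]`
(the structural parent `Concavity`, stmt-8150, restricted to `[-1,0]` as refuter g3 suggested). -/
theorem stub_concavityAF :
    ∀ (M : ℕ) [NeZero M], Even M → 4 ≤ M → ∀ (Δ₁ Δ₂ Δ₃ : ℝ), -1 ≤ Δ₁ → Δ₁ ≤ Δ₂ → Δ₂ ≤ Δ₃ → Δ₃ ≤ 0 → ∀ (ψ₁ ψ₂ ψ₃ : Literature.MathematicalPhysics.QuantumLattice.TensorIndex (Literature.Probability.LatticeModels.TorusSite 2 M) 2 → ℂ), ψ₁ ∈ Literature.MathematicalPhysics.QuantumLattice.spinZSector (Λ := Literature.Probability.LatticeModels.TorusSite 2 M) 1 0 → star ψ₁ ⬝ᵥ ψ₁ = 1 → Matrix.mulVec (Literature.MathematicalPhysics.QuantumLattice.xxzHamiltonian 1 (Literature.Probability.LatticeModels.torusGraph 2 M) (-1) Δ₁) ψ₁ = ((Literature.MathematicalPhysics.QuantumLattice.lowestEnergyInSector 1 (Literature.MathematicalPhysics.QuantumLattice.xxzHamiltonian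 1 (Literature.Probability.LatticeModels.torusGraph 2 M) (-1) Δ₁) 0 : ℝ) : ℂ) • ψ₁ → ψ₂ ∈ Literature.MathematicalPhysics.QuantumLattice.spinZSector (Λ := Literature.Probability.LatticeModels.TorusSite 2 M) 1 0 → star ψ₂ ⬝ᵥ ψ₂ = 1 → Matrix.mulVec (Literature.MathematicalPhysics.QuantumLattice.xxzHamiltonian 1 (Literature.Probability.LatticeModels.torusGraph 2 M) (-1) Δ₂) ψ₂ = ((Literature.MathematicalPhysics.QuantumLattice.lowestEnergyInSector 1 (Literature.MathematicalPhysics.QuantumLattice.xxzHamiltonian 1 (Literature.Probability.LatticeModels.torusGraph 2 M) (-1) Δ₂) 0 : ℝ) : ℂ) • ψ₂ → ψ₃ ∈ Literature.MathematicalPhysics.QuantumLattice.spinZSector (Λ := Literature.Probability.LatticeModels.TorusSite 2 M) 1 0 → star ψ₃ ⬝ᵥ ψ₃ = 1 → Matrix.mulVec (Literature.MathematicalPhysics.QuantumLattice.xxzHamiltonian 1 (Literature.Probability.LatticeModels.torusGraph 2 M) (-1) Δ₃) ψ₃ = ((Literature.MathematicalPhysics.QuantumLattice.lowestEnergyInSector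 1 (Literature.MathematicalPhysics.QuantumLattice.xxzHamiltonian 1 (Literature.Probability.LatticeModels.torusGraph 2 M) (-1) Δ₃) 0 : ℝ) : ℂ) • ψ₃ → (Δ₃ - Δ₂) * (star ψ₁ ⬝ᵥ Matrix.mulVec ((∑ x : Literature.Probability.LatticeModels.TorusSite 2 M, Literature.MathematicalPhysics.QuantumLattice.onSite x (Literature.MathematicalPhysics.QuantumLattice.spinRaise 1)) * (∑ y : Literature.Probability.LatticeModels.TorusSite 2 M, Literature.MathematicalPhysics.QuantumLattice.onSite y (Literature.MathematicalPhysics.QuantumLattice.spinLower 1))) ψ₁).re + (Δ₂ - Δ₁) * (star ψ₃ ⬝ᵥ Matrix.mulVec ((∑ x : Literature.Probability.LatticeModels.TorusSite 2 M, Literature.MathematicalPhysics.QuantumLattice.onSite x (Literature.MathematicalPhysics.QuantumLattice.spinRaise 1)) * (∑ y : Literature.Probability.LatticeModels.TorusSite 2 M, Literature.MathematicalPhysics.QuantumLattice.onSite y (Literature.MathematicalPhysics.QuantumLattice.spinLower 1))) ψ₃).re ≤ (Δ₃ - Δ₁) * (star ψ₂ ⬝ᵥ Matrix.mulVec ((∑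 x : Literature.Probability.LatticeModels.TorusSite 2 M, Literature.MathematicalPhysics.QuantumLattice.onSite x (Literature.MathematicalPhysics.QuantumLattice.spinRaise 1)) * (∑ y : Literature.Probability.LatticeModels.TorusSite 2 M, Literature.MathematicalPhysics.QuantumLattice.onSite y (Literature.MathematicalPhysics.QuantumLattice.spinLower 1))) ψ₂).re := by
  sorry

/-- STUB 2 = the FM-side piece `FerroSideChord` (route item stmt-HubbardSuperconductivity-19089, BY
NAME; shared with line `split-chordxy-ferroside`, refined by line `fm-monotone-anchor`). -/
theorem stub_ferroSideChord : FerroSideChord := by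
  sorry

/-- **A normalised `S^z_tot = 0` sector ground state of `H_M(Δ)` exists, for every anisotropy `Δ`**
(even `M`): the XXZ matrix is real symmetric, `-½ ≤ 0` off the diagonal per hop, weight preserving
(`leadPF_entries` at zero field), the torus graph is connected, so the BEC route's
`stoquastic_sector_perronFrobenius` gives a (Perron) ground vector of the half-filled weight sector
`W = M²/2`, i.e. magnetisation `0`; normalise with `exists_smul_unit`. Tasaki (2020) §2.4. [folklore] -/
theorem exists_unit_sectorGroundState_xxz (M : ℕ) [NeZero M] (hM : Even M) (Δ : ℝ) :
    ∃ ψ : TensorIndex (TorusSite 2 M) 2 → ℂ,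
      ψ ∈ spinZSector (Λ := TorusSite 2 M) 1 0 ∧ star ψ ⬝ᵥ ψ = 1 ∧
        xxzHamiltonian 1 (torusGraph 2 M) (-1) Δ *ᵥ ψ =
          ((lowestEnergyInSector 1 (xxzHamiltonian 1 (torusGraph 2 M) (-1) Δ) 0 : ℝ) : ℂ) • ψ := by
  have hent := leadPF_entries (torusGraph 2 M) Δ (fun _ => (0 : ℝ))
  simp only [Complex.ofReal_zero, zero_smul, Finset.sum_const_zero, add_zero] at hent
  obtain ⟨happ, hreal, hsymm, hoff, hwt⟩ := hent
  have hW : ∃ σ : TensorIndex (TorusSite 2 M) 2, (∑ z, (σ z : ℕ)) = M ^ 2 / 2 :=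
    exists_config_weight_eq 2 M (M ^ 2 / 2) (Nat.div_le_self _ _)
  obtain ⟨⟨ψ, hψK, hψ0, -, hHψ⟩, -⟩ :=
    stoquastic_sector_perronFrobenius 1 (torusGraph 2 M) (torusGraph_connected 2 M)
      (xxzHamiltonian 1 (torusGraph 2 M) (-1) Δ)
      (fun σ τ hστ h h0 => h (neg_eq_zero.1 ((happ σ τ hστ).symm.trans h0)))
      hreal hsymm hoff hwt (M ^ 2 / 2) hW
  have hlabel : ((Fintype.card (TorusSite 2 M) * 1 : ℕ) : ℝ) / 2 - ((M ^ 2 / 2 : ℕ) : ℝ) = 0 := by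
    obtain ⟨k, rfl⟩ := hM
    have hk : (k + k) ^ 2 / 2 = 2 * k ^ 2 := by
      rw [show (k + k) ^ 2 = 2 * (2 * k ^ 2) by ring, Nat.mul_div_cancel_left _ (by norm_num)]
    rw [card_torusSite, hk]
    push_cast
    ring
  rw [hlabel] at hψK hHψ
  obtain ⟨a, -, ha1⟩ := exists_smul_unit hψ0
  refine ⟨a • ψ, Submodule.smul_mem _ _ hψK, ha1, ?_⟩
  rw [mulVec_smul, hHψ, smul_comm]

/-- `Λ(ψ) = ‖S⁻_tot ψ‖² ≥ 0` (`S⁻_tot = (S⁺_tot)†`, `IsSu2Triple.star_M_mulVec_dotProduct`). [folklore] -/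
theorem lam_nonneg :
    ∀ (M : ℕ) [NeZero M] (ψ : Literature.MathematicalPhysics.QuantumLattice.TensorIndex (Literature.Probability.LatticeModels.TorusSite 2 M) 2 → ℂ), 0 ≤ (star ψ ⬝ᵥ Matrix.mulVec ((∑ x : Literature.Probability.LatticeModels.TorusSite 2 M, Literature.MathematicalPhysics.QuantumLattice.onSite x (Literature.MathematicalPhysics.QuantumLattice.spinRaise 1)) * (∑ y : Literature.Probability.LatticeModels.TorusSite 2 M, Literature.MathematicalPhysics.QuantumLattice.onSite y (Literature.MathematicalPhysics.QuantumLattice.spinLower 1))) ψ).re := by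
  intro M _ ψ
  have hsu2 := isSu2Triple_on 1 (Finset.univ : Finset (TorusSite 2 M))
  have h : star ψ ⬝ᵥ Matrix.mulVec ((∑ x : Literature.Probability.LatticeModels.TorusSite 2 M, Literature.MathematicalPhysics.QuantumLattice.onSite x (Literature.MathematicalPhysics.QuantumLattice.spinRaise 1)) * (∑ y : Literature.Probability.LatticeModels.TorusSite 2 M, Literature.MathematicalPhysics.QuantumLattice.onSite y (Literature.MathematicalPhysics.QuantumLattice.spinLower 1))) ψ =
      star (lowerOn 1 Finset.univ *ᵥ ψ) ⬝ᵥ (lowerOn 1 Finset.univ *ᵥ ψ) := by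
    rw [hsu2.star_M_mulVec_dotProduct, mulVec_mulVec]
    rfl
  rw [h]
  rw [dotProduct, Complex.re_sum]
  refine Finset.sum_nonneg fun i _ => ?_
  rw [Pi.star_apply, Complex.star_def, mul_comm, Complex.mul_conj, Complex.ofReal_re]
  exact Complex.normSq_nonneg _

/-- COMPOSITION TO THE PIECE — concavity on `[-1,0]` gives the route item `ChordXY` (stmt-8146) by
name (points `(-1, Δ, 0)`, the AF ground state exists, `Λ ≥ 0`). [folklore] -/
theorem chordXY_of_concavityAF
    (hConc : ∀ (M : ℕ) [NeZero M], Even M → 4 ≤ M → ∀ (Δ₁ Δ₂ Δ₃ : ℝ), -1 ≤ Δ₁ → Δ₁ ≤ Δ₂ → Δ₂ ≤ Δ₃ → Δ₃ ≤ 0 → ∀ (ψ₁ ψ₂ ψ₃ : Literature.MathematicalPhysics.QuantumLattice.TensorIndex (Literature.Probability.LatticeModels.TorusSite 2 M) 2 → ℂ), ψ₁ ∈ Literature.MathematicalPhysics.QuantumLattice.spinZSector (Λ := Literature.Probability.LatticeModels.TorusSite 2 M) 1 0 → star ψ₁ ⬝ᵥ ψ₁ = 1 → Matrix.mulVec (Literature.MathematicalPhysics.QuantumLattice.xxzHamiltonian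 1 (Literature.Probability.LatticeModels.torusGraph 2 M) (-1) Δ₁) ψ₁ = ((Literature.MathematicalPhysics.QuantumLattice.lowestEnergyInSector 1 (Literature.MathematicalPhysics.QuantumLattice.xxzHamiltonian 1 (Literature.Probability.LatticeModels.torusGraph 2 M) (-1) Δ₁) 0 : ℝ) : ℂ) • ψ₁ → ψ₂ ∈ Literature.MathematicalPhysics.QuantumLattice.spinZSector (Λ := Literature.Probability.LatticeModels.TorusSite 2 M) 1 0 → star ψ₂ ⬝ᵥ ψ₂ = 1 → Matrix.mulVec (Literature.MathematicalPhysics.QuantumLattice.xxzHamiltonian 1 (Literature.Probability.LatticeModels.torusGraph 2 M) (-1) Δ₂) ψ₂ = ((Literature.MathematicalPhysics.QuantumLattice.lowestEnergyInSector 1 (Literature.MathematicalPhysics.QuantumLattice.xxzHamiltonian 1 (Literature.Probability.LatticeModels.torusGraph 2 M) (-1) Δ₂) 0 : ℝ) : ℂ) • ψ₂ → ψ₃ ∈ Literature.MathematicalPhysics.QuantumLattice.spinZSector (Λ := Literature.Probability.LatticeModels.TorusSite 2 M) 1 0 → star ψ₃ ⬝ᵥ ψ₃ = 1 → Matrix.mulVec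 (Literature.MathematicalPhysics.QuantumLattice.xxzHamiltonian 1 (Literature.Probability.LatticeModels.torusGraph 2 M) (-1) Δ₃) ψ₃ = ((Literature.MathematicalPhysics.QuantumLattice.lowestEnergyInSector 1 (Literature.MathematicalPhysics.QuantumLattice.xxzHamiltonian 1 (Literature.Probability.LatticeModels.torusGraph 2 M) (-1) Δ₃) 0 : ℝ) : ℂ) • ψ₃ → (Δ₃ - Δ₂) * (star ψ₁ ⬝ᵥ Matrix.mulVec ((∑ x : Literature.Probability.LatticeModels.TorusSite 2 M, Literature.MathematicalPhysics.QuantumLattice.onSite x (Literature.MathematicalPhysics.QuantumLattice.spinRaise 1)) * (∑ y : Literature.Probability.LatticeModels.TorusSite 2 M, Literature.MathematicalPhysics.QuantumLattice.onSite y (Literature.MathematicalPhysics.QuantumLattice.spinLower 1))) ψ₁).re + (Δ₂ - Δ₁) * (star ψ₃ ⬝ᵥ Matrix.mulVec ((∑ x : Literature.Probability.LatticeModels.TorusSite 2 M, Literature.MathematicalPhysics.QuantumLattice.onSite x (Literature.MathematicalPhysics.QuantumLattice.spinRaise 1)) * (∑ y : Literature.Probability.LatticeModels.TorusSite 2 M,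 Literature.MathematicalPhysics.QuantumLattice.onSite y (Literature.MathematicalPhysics.QuantumLattice.spinLower 1))) ψ₃).re ≤ (Δ₃ - Δ₁) * (star ψ₂ ⬝ᵥ Matrix.mulVec ((∑ x : Literature.Probability.LatticeModels.TorusSite 2 M, Literature.MathematicalPhysics.QuantumLattice.onSite x (Literature.MathematicalPhysics.QuantumLattice.spinRaise 1)) * (∑ y : Literature.Probability.LatticeModels.TorusSite 2 M, Literature.MathematicalPhysics.QuantumLattice.onSite y (Literature.MathematicalPhysics.QuantumLattice.spinLower 1))) ψ₂).re) :
    ChordXY := by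
  intro M _ hE h4 Δ hΔ ψ₀ ψ hmem₀ hψ₀1 heig₀ hmem hψ1 heig
  obtain ⟨ψ₁, hmem₁, hψ₁1, heig₁⟩ := exists_unit_sectorGroundState_xxz M hE (-1)
  have hC := hConc M hE h4 (-1) Δ 0 le_rfl hΔ.1 hΔ.2 le_rfl ψ₁ ψ ψ₀ hmem₁ hψ₁1 heig₁ hmem hψ1 heig
    hmem₀ hψ₀1 heig₀
  have hL := lam_nonneg M ψ₁
  have hnegΔ : 0 ≤ -Δ := by linarith [hΔ.2]
  have hdrop : 0 ≤ (0 - Δ) * (star ψ₁ ⬝ᵥ Matrix.mulVec ((∑ x : Literature.Probability.LatticeModels.TorusSite 2 M, Literature.MathematicalPhysics.QuantumLattice.onSite x (Literature.MathematicalPhysics.QuantumLattice.spinRaise 1)) * (∑ y : Literature.Probability.LatticeModels.TorusSite 2 M, Literature.MathematicalPhysics.QuantumLattice.onSite y (Literature.MathematicalPhysics.QuantumLattice.spinLower 1))) ψ₁).re := by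
    rw [zero_sub]; exact mul_nonneg hnegΔ hL
  have hC' : (0 - Δ) * (star ψ₁ ⬝ᵥ Matrix.mulVec ((∑ x : Literature.Probability.LatticeModels.TorusSite 2 M, Literature.MathematicalPhysics.QuantumLattice.onSite x (Literature.MathematicalPhysics.QuantumLattice.spinRaise 1)) * (∑ y : Literature.Probability.LatticeModels.TorusSite 2 M, Literature.MathematicalPhysics.QuantumLattice.onSite y (Literature.MathematicalPhysics.QuantumLattice.spinLower 1))) ψ₁).re + (Δ - (-1)) * (star ψ₀ ⬝ᵥ Matrix.mulVec ((∑ x : Literature.Probability.LatticeModels.TorusSite 2 M, Literature.MathematicalPhysics.QuantumLattice.onSite x (Literature.MathematicalPhysics.QuantumLattice.spinRaise 1)) * (∑ y : Literature.Probability.LatticeModels.TorusSite 2 M, Literature.MathematicalPhysics.QuantumLattice.onSite y (Literature.MathematicalPhysics.QuantumLattice.spinLower 1))) ψ₀).re ≤ (0 - (-1)) * (star ψ ⬝ᵥ Matrix.mulVec ((∑ x : Literature.Probability.LatticeModels.TorusSite 2 M, Literature.MathematicalPhysics.QuantumLattice.onSite x (Literature.MathematicalPhysics.QuantumLattice.spinRaise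 1)) * (∑ y : Literature.Probability.LatticeModels.TorusSite 2 M, Literature.MathematicalPhysics.QuantumLattice.onSite y (Literature.MathematicalPhysics.QuantumLattice.spinLower 1))) ψ).re := hC
  have h1 : (Δ - (-1)) = 1 + Δ := by ring
  rw [h1] at hC'
  linarith


/-- COMPOSITION TO THE CRUX BY NAME — `ChordFM` from the registered stubs. The split assembly
`ChordXY → FerroSideChord → ChordFM` (= glue item `ChordFMOfPieces`, stmt-19090, whose complete proof is
attached as evidence `AnisotropyChordChordFMOfPieces.lean`) is re-proved INSIDE this theorem so that the
line is self-contained and exactly one theorem of the file concludes the crux. Sorries live only in `stub_*`. -/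
theorem ChordFM_of : ChordFM :=
  have pieces : ChordXY → FerroSideChord → ChordFM := by
    intro hXY hF M _ hE h4 Δ hΔ ψ hmem hψ1 heig
    by_cases hΔ0 : 0 ≤ Δ
    · -- ferromagnetic side `Δ ∈ [0,1]`: the FM-side piece verbatim
      exact hF M hE h4 Δ ⟨hΔ0, hΔ.2⟩ ψ hmem hψ1 heig
    · -- antiferromagnetic side `Δ ∈ [-1,0)`: RP-free anchor at the KLS point, transported by ChordXY
      obtain ⟨ψ₀, hmem₀, hψ₀1, heig₀⟩ :=
        exists_unit_sectorGroundState_xy M hE (le_trans (by norm_num) h4)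
      have hA := hF M hE h4 0 ⟨le_rfl, by norm_num⟩ ψ₀ hmem₀ hψ₀1 heig₀
      have hC := hXY M hE h4 Δ ⟨hΔ.1, (not_le.mp hΔ0).le⟩ ψ₀ ψ hmem₀ hψ₀1 heig₀ hmem hψ1 heig
      have h1 : 0 ≤ 1 + Δ := by linarith [hΔ.1]
      calc (1 + Δ) / 2 * ((M : ℝ) ^ 2 / 2 * ((M : ℝ) ^ 2 / 2 + 1))
          = (1 + Δ) * ((1 + 0) / 2 * ((M : ℝ) ^ 2 / 2 * ((M : ℝ) ^ 2 / 2 + 1))) := by ring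
        _ ≤ (1 + Δ) * (star ψ₀ ⬝ᵥ Matrix.mulVec ((∑ x : TorusSite 2 M, onSite x (spinRaise 1)) *
              (∑ y : TorusSite 2 M, onSite y (spinLower 1))) ψ₀).re :=
            mul_le_mul_of_nonneg_left hA h1
        _ ≤ _ := hC
  pieces (chordXY_of_concavityAF stub_concavityAF) stub_ferroSideChord

end Summit.HubbardSuperconductivity.HubbardSuperconductivity.Cruxes.ChordFM.ConcavityAF
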